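import Mathlib
import Summits.PneNP.PneNP.Theorems.ClusUniversalCertificateCoordInv
import Summits.PneNP.PneNP.Theorems.ClusUniversalCertificateCoordBookBlk

/-!
# Route ClusUniversalCertificate, crux `UniversalCertAll` — the CORE STEP follows from BLOCK LAYERING ON THE CORE

Support theorem for the registered line `slicing` (skeleton sha16 965b363e1847, stmt-PneNP-19683; planner pnp-ideate-p1 g19).  The tree proves
`UniversalCertAll` ⟸ core step (`ClusCoord.stub_reduce`, p714962); this file proves  core step ⟸ INTEGRAL BLOCK LAYERING ON THE CORE:
if every hard-core set (zero-rare in every admissible frame, at least three nonempty blocks, a block of size `≥ 2`, a zero in every nonempty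
block; the mixed certificate below `M` may be assumed) admits, in some admissible frame `g` (`BZP`), a nonempty block `k` and an integral
block-layer family over the remaining coordinates with the block-layer inequality (`IsBLayerFamily`, `BLayerIneq`), then the core step holds —
the members live in total dimension `M' < M` (`card_filter_ne_lt`), the induction hypothesis certifies them, `stub_cBookBlk` assembles the
certificate of the image and `stub_inv` pulls it back.  The hypothesis is the tree conjecture `ClusCoord.IBL` restricted to the core with gauge
freedom; it is OPEN (evidence: Cruxes/UniversalCertAll/Lines/slicing.md §13b–§14).  FRONTIER rung F-N1; nothing here bears on P vs NP.
-/

set_option linter.dupNamespace false -- `Summit.PneNP.PneNP.…`: summit = sub-problem name (D-0017 single-conjunct layout)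

namespace Summit.PneNP.PneNP.Theorems.ClusCoord

open Finset

/-- **Core step from block layering on the core.**  Hypothesis: INTEGRAL BLOCK LAYERING ON THE HARD CORE (open; `ClusCoord.IBL` restricted to the
core, with gauge freedom and the induction hypothesis available).  Conclusion: the registered stub `stub_core` of line `slicing` verbatim — so with
`ClusCoord.stub_reduce` and `ClusCoord.stub_transfer` the crux `UniversalCertAll` follows from the hypothesis. -/
theorem stub_core_of_iblCore :
    (∀ M : ℕ, (∀ M' : ℕ, M' < M → UCMixDim M') →
      ∀ (n : ℕ) (blk : Fin M → Fin n) (Y : Finset (Fin M → ZMod 2)),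
        GZeroRare blk Y → 2 < (univ.filter fun j : Fin n => 0 < bsize blk j).card → (∃ j : Fin n, 1 < bsize blk j) →
        (∀ j : Fin n, 0 < bsize blk j → 0 < zcount blk j Y) →
        ∃ g : (Fin M → ZMod 2) ≃ₗ[ZMod 2] (Fin M → ZMod 2), BZP blk g ∧ ∃ k : Fin n, 0 < bsize blk k ∧
          ∃ M' : ℕ, ∃ h : (univ.filter fun i => blk i ≠ k).card = M', ∃ L : List (Finset (Fin M' → ZMod 2)),
            IsBLayerFamily blk (Y.image fun y => g y) k M' h L ∧ BLayerIneq M n blk (Y.image fun y => g y) k M' L) →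
    ∀ M : ℕ, (∀ M' : ℕ, M' < M → UCMixDim M') →
      ∀ (n : ℕ) (blk : Fin M → Fin n) (Y : Finset (Fin M → ZMod 2)),
        GZeroRare blk Y → 2 < (univ.filter fun j : Fin n => 0 < bsize blk j).card → (∃ j : Fin n, 1 < bsize blk j) →
        (∀ j : Fin n, 0 < bsize blk j → 0 < zcount blk j Y) →
        UCMix M n blk Y := by
  intro hI M ih n blk Y hzr h3 hbig hz
  obtain ⟨g, hg, k, hk, M', h, L, hfam, hineq⟩ := hI M ih n blk Y hzr h3 hbig hz
  have hM' : M' < M := h ▸ card_filter_ne_lt blk k hk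
  exact stub_inv M n blk Y g hg (stub_cBookBlk M M' n blk _ k h L hfam hineq (fun S _ => ih M' hM' n _ S))

end Summit.PneNP.PneNP.Theorems.ClusCoord
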